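import Mathlib
import Literature.NumberTheory.Sieve.Maynard2016IntervalPrimes
import HarnessLib

/-!
# Maynard 2016, Lemma 7: `|𝓡_m| ≫ x/log⁴ x` and the primes of `𝓘_m`, packaged

Topic `Literature/NumberTheory/Sieve`. J. Maynard, *Large gaps between primes*, Ann. of Math. (2)
183 (2016), 915–933 = arXiv:1408.5110, §6, proof of Lemma 7, between (6.29) and (6.30):
"`𝓘_m` is an interval of length `δ|𝓡_m| log x ≫ x(log x)^{−2}` by Lemma 3 and our bound on `m`.
Since `𝓘_m` is contained in `[x/2, x]`, the number of primes in `𝓘_m` is `(1+o(1))|𝓘_m|/log x`."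

PROVED here (no named facts), packaging Lemma 3 (tree: `lemma3_holds`), the pointwise bound
`card_Rm_ge` (`|𝓡_m| ≥ x/(8 log⁴ x)`), Mertens from below (`oddPrimeProd_ge`) and the prime count
`eventually_card_intervalPrimes_ge` into statements with the quantifier shape of `Lemma7Tuple`:
`eventually_card_Rm_ge` (for `ε ∈ (0, 1/2]`, all large `x` and every even
`1 ≤ m < U z⁻¹(log₂ x)⁻²`: `|𝓡_m| ≥ x/(8 log⁴ x)`) and `eventually_card_intervalPrimes_ge_of_Rm`
(additionally for `x/2 ≤ A ≤ B ≤ x` with `B − A ≥ δ|𝓡_m| log x`: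
`#{q prime : A ≤ q ≤ B} ≥ (1 − κ)(B − A)/log x`).

## References

* J. Maynard, *Large gaps between primes*, Ann. of Math. (2) 183 (2016), 915–933; arXiv:1408.5110,
  Lemma 3 and Lemma 7 (proof). [Maynard2016LargeGaps]
-/

open Filter Finset
open scoped Topology

namespace Literature.NumberTheory.Sieve

namespace Maynard2016

/-- `K e^{−√t} ≤ 1/2` once `t ≥ (log 2K)²` (`K > 0`). [folklore] -/
private theorem K_mul_exp_neg_sqrt_le {K t : ℝ} (hK : 0 < K)
    (ht : Real.log (2 * K) ^ 2 ≤ t) : K * Real.exp (-t ^ ((1 : ℝ) / 2)) ≤ 1 / 2 := by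
  have hs : t ^ ((1 : ℝ) / 2) = Real.sqrt t := (Real.sqrt_eq_rpow t).symm
  rw [hs]
  rcases le_or_gt (Real.log (2 * K)) 0 with h | h
  · -- `2K ≤ 1`
    have h2K : 2 * K ≤ 1 := by
      by_contra hlt
      exact absurd (Real.log_pos (not_le.1 hlt)) (not_lt.2 h)
    have : Real.exp (-Real.sqrt t) ≤ 1 := by
      rw [Real.exp_le_one_iff]; linarith [Real.sqrt_nonneg t]
    nlinarith
  · have h1 : Real.log (2 * K) ≤ Real.sqrt t := Real.le_sqrt_of_sq_le ht
    have h2 : Real.exp (-Real.sqrt t) ≤ Real.exp (-Real.log (2 * K)) :=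
      Real.exp_le_exp.2 (by linarith)
    have h3 : Real.exp (-Real.log (2 * K)) = (2 * K)⁻¹ := by
      rw [Real.exp_neg, Real.exp_log (by linarith)]
    rw [h3] at h2
    calc K * Real.exp (-Real.sqrt t) ≤ K * (2 * K)⁻¹ := mul_le_mul_of_nonneg_left h2 hK.le
      _ = 1 / 2 := by field_simp

/-- The facts at a large `x` feeding `card_Rm_ge`, for `0 < ε ≤ 1/2` and `K > 0`:
`1 ≤ log x`, `4 ≤ log₂ x ≤ log x`, `0 < z`, `U ≤ x log² x`, `K e^{−√log₂ x} ≤ 1/2`,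
`P_y ≥ 1/(4 log² x)`, `U/(z log₂² x) ≤ x`, and `8/δ ≤ log x`. [cite: Maynard2016LargeGaps, §2 display (2.1)] -/
private theorem eventually_facts_Rm {C_U K δ : ℝ} (hC : 0 < C_U) (hK : 0 < K) {ε : ℝ}
    (hε0 : 0 < ε) (hε : ε ≤ 1 / 2) :
    ∀ᶠ x : ℕ in atTop,
      1 ≤ Real.log x ∧ 4 ≤ Real.log (Real.log x) ∧ Real.log (Real.log x) ≤ Real.log x ∧
      0 < z x ∧ U C_U ε x ≤ (x : ℝ) * Real.log x ^ 2 ∧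
      K * Real.exp (-(Real.log (Real.log x)) ^ ((1 : ℝ) / 2)) ≤ 1 / 2 ∧
      1 / (4 * Real.log x ^ 2) ≤ oddPrimeProd ⌊y ε x⌋₊ ∧
      U C_U ε x / (z x * Real.log (Real.log x) ^ 2) ≤ x ∧ 8 / δ ≤ Real.log x := by
  have hT₁ : Tendsto (fun X : ℝ => Real.log X) atTop atTop := Real.tendsto_log_atTop
  have hT₂ : Tendsto (fun X : ℝ => Real.log (Real.log X)) atTop atTop :=
    Real.tendsto_log_atTop.comp hT₁
  have hT₃ : Tendsto (fun X : ℝ => Real.log (Real.log (Real.log X))) atTop atTop :=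
    Real.tendsto_log_atTop.comp hT₂
  have hreal : ∀ᶠ X : ℝ in atTop, 4 ≤ Real.log (Real.log X) ∧
      98 ≤ Real.log (Real.log (Real.log X)) ∧ C_U ≤ Real.log X ∧
      Real.log (2 * K) ^ 2 ≤ Real.log (Real.log X) ∧ 8 / δ ≤ Real.log X := by
    filter_upwards [hT₂.eventually_ge_atTop 4, hT₃.eventually_ge_atTop 98,
      hT₁.eventually_ge_atTop C_U, hT₂.eventually_ge_atTop (Real.log (2 * K) ^ 2),
      hT₁.eventually_ge_atTop (8 / δ)] with X h1 h2 h3 h4 h5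
    exact ⟨h1, h2, h3, h4, h5⟩
  filter_upwards [tendsto_natCast_atTop_atTop.eventually hreal, eventually_iteratedLogs,
    eventually_gt_atTop 0] with x hx hlogs hx0
  obtain ⟨hL₂4, hL₃98, hCL, hKL, hδL⟩ := hx
  obtain ⟨hL4, -, -, hL₃L₂, hL₂L, -, hsq⟩ := hlogs
  set L := Real.log x with hLdef
  set L₂ := Real.log (Real.log x) with hL₂def
  set L₃ := Real.log (Real.log (Real.log x)) with hL₃def
  have hx0' : (0 : ℝ) < x := by exact_mod_cast hx0
  have hL0 : 0 < L := by linarith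
  have hL₂0 : 0 < L₂ := by linarith
  have hL₂1 : 1 ≤ L₂ := by linarith
  have hz0 : 0 < z x := by unfold z; rw [← hL₂def]; positivity
  -- `log y`
  have hlyL : Real.log (y ε x) ≤ L := by
    rw [log_y, ← hLdef, ← hL₂def, ← hL₃def]
    have h1 : L * L₃ / L₂ ≤ L := by
      rw [div_le_iff₀ hL₂0]; nlinarith
    have h2 : 0 ≤ L * L₃ / L₂ := by positivity
    nlinarith
  have hly49 : 49 ≤ Real.log (y ε x) := by
    have := half_log₃_le_log_y hε hL₂0 (by linarith) (by linarith : (0 : ℝ) ≤ L₃)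
    rw [← hL₃def] at this; linarith
  have hly0 : 0 < Real.log (y ε x) := by linarith
  -- `U ≤ x log² x` and `U/(z log₂²) ≤ x`
  have hUeq : U C_U ε x = C_U * (x * Real.log (y ε x) / L₂) := by unfold U; rw [← hL₂def]
  have hU1 : U C_U ε x ≤ C_U * (x * Real.log (y ε x)) := by
    rw [hUeq]
    exact mul_le_mul_of_nonneg_left (div_le_self (by positivity) hL₂1) hC.le
  have hU2 : C_U * (x * Real.log (y ε x)) ≤ L * (x * L) :=
    mul_le_mul hCL (mul_le_mul_of_nonneg_left hlyL hx0'.le) (by positivity) hL0.le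
  have hUx : U C_U ε x ≤ (x : ℝ) * L ^ 2 := by nlinarith
  have hUz : U C_U ε x / (z x * L₂ ^ 2) ≤ x := by
    rw [div_le_iff₀ (by positivity)]
    have hz : z x * L₂ ^ 2 = x * L₂ := by unfold z; rw [← hL₂def]; field_simp
    rw [hz]
    -- `U ≤ C_U x log y ≤ L · x · L = x L² ≤ x · x`? we need `U ≤ x · (x L₂)`:
    have h1 : L * (x * L) = x * L ^ 2 := by ring
    have h2 : (x : ℝ) * L ^ 2 ≤ x * (x * L₂) := by
      apply mul_le_mul_of_nonneg_left _ hx0'.le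
      nlinarith
    nlinarith
  -- `P_y ≥ 1/(4 log² x)`
  have hy0 : 0 < y ε x := by unfold y; exact Real.exp_pos _
  have hy49 : Real.exp 49 ≤ y ε x := by
    have := Real.exp_le_exp.2 hly49
    rwa [Real.exp_log hy0] at this
  have hY48 : Real.exp 48 ≤ (⌊y ε x⌋₊ : ℝ) := by
    have h1 : y ε x < ⌊y ε x⌋₊ + 1 := Nat.lt_floor_add_one _
    have h2 : Real.exp 49 = Real.exp 1 * Real.exp 48 := by rw [← Real.exp_add]; norm_num
    have h3 : (2 : ℝ) < Real.exp 1 := by have := Real.exp_one_gt_d9; linarith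
    have h4 : (1 : ℝ) ≤ Real.exp 48 := Real.one_le_exp (by norm_num)
    nlinarith
  have hYpos : (0 : ℝ) < ⌊y ε x⌋₊ := lt_of_lt_of_le (Real.exp_pos 48) hY48
  have hlogY0 : 0 < Real.log (⌊y ε x⌋₊ : ℝ) := by
    have := Real.log_le_log (Real.exp_pos 48) hY48
    rw [Real.log_exp] at this; linarith
  have hlogYL : Real.log (⌊y ε x⌋₊ : ℝ) ≤ L :=
    (Real.log_le_log hYpos (Nat.floor_le hy0.le)).trans hlyL
  have hP : 1 / (4 * L ^ 2) ≤ oddPrimeProd ⌊y ε x⌋₊ := by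
    refine le_trans ?_ (oddPrimeProd_ge hY48)
    have : Real.log (⌊y ε x⌋₊ : ℝ) ^ 2 ≤ L ^ 2 := pow_le_pow_left₀ hlogY0.le hlogYL 2
    exact div_le_div_of_nonneg_left zero_le_one (mul_pos four_pos (pow_pos hlogY0 2)) (by linarith)
  exact ⟨by linarith, hL₂4, by linarith, hz0, hUx,
    K_mul_exp_neg_sqrt_le hK hKL, hP, hUz, hδL⟩

/-- **`|𝓡_m| ≥ x/(8 log⁴ x)`** for `0 < ε ≤ 1/2`, all large `x` and every even
`1 ≤ m < U z⁻¹ (log₂ x)⁻²` (Lemma 3, PROVED in the tree, + Mertens from below).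
[cite: Maynard2016LargeGaps, Lemma 7 (proof, «|𝓘_m| = δ|𝓡_m| log x ≫ x (log x)⁻² by Lemma 3»)] -/
theorem eventually_card_Rm_ge {C_U : ℝ} (hCU : 0 < C_U) :
    ∀ᶠ ε : ℝ in 𝓝[>] 0, ∀ᶠ x : ℕ in atTop, ∀ m : ℕ, 1 ≤ m → Even m →
      (m : ℝ) < U C_U ε x / (z x * Real.log (Real.log x) ^ 2) →
        (x : ℝ) / (8 * Real.log x ^ 4) ≤ ((Rm C_U ε x m).card : ℝ) := by
  have hεhalf : ∀ᶠ ε : ℝ in 𝓝[>] 0, ε ≤ 1 / 2 :=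
    eventually_nhdsWithin_of_eventually_nhds (eventually_le_nhds (by norm_num : (0 : ℝ) < 1 / 2))
  have hεpos : ∀ᶠ ε : ℝ in 𝓝[>] 0, 0 < ε := eventually_mem_nhdsWithin
  filter_upwards [lemma3_holds, hεhalf, hεpos] with ε h3ε hε hε0
  obtain ⟨K, hK, h3x⟩ := h3ε
  filter_upwards [h3x, eventually_facts_Rm (δ := 1) hCU hK hε0 hε] with x h3xx hfx
  obtain ⟨hL1, hL₂4, hL₂L, hz0, hUx, hκ, hP, hUz, -⟩ := hfx
  intro m hm1 hmev hmW
  have hmx : m ≤ x := by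
    have : (m : ℝ) ≤ x := by linarith
    exact_mod_cast this
  exact card_Rm_ge hκ hL1 hL₂4 hL₂L hz0 hUx hP hm1 hmx hmev hmW h3xx

/-- **The primes of `𝓘_m`, in the quantifier shape of `Lemma7Tuple`:** for `δ, κ > 0`, for
`ε ∈ (0, 1/2]` near `0⁺`, all large `x`, every even `1 ≤ m < U z⁻¹(log₂ x)⁻²` and every
`x/2 ≤ A`, `B ≤ x` with `B − A ≥ δ |𝓡_m| log x`:
`#{q prime : A ≤ q ≤ B} ≥ (1 − κ)(B − A)/log x`. [cite: Maynard2016LargeGaps, Lemma 7 (proof, «the number of primes in 𝓘_m is (1+o(1))|𝓘_m|/log x»)] -/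
theorem eventually_card_intervalPrimes_ge_of_Rm {C_U : ℝ} (hCU : 0 < C_U) {δ κ : ℝ}
    (hδ : 0 < δ) (hκ : 0 < κ) :
    ∀ᶠ ε : ℝ in 𝓝[>] 0, ∀ᶠ x : ℕ in atTop, ∀ m : ℕ, 1 ≤ m → Even m →
      (m : ℝ) < U C_U ε x / (z x * Real.log (Real.log x) ^ 2) →
        ∀ A B : ℝ, (x : ℝ) / 2 ≤ A → B ≤ x →
          δ * (Rm C_U ε x m).card * Real.log x ≤ B - A →
            (1 - κ) * ((B - A) / Real.log x) ≤ ((intervalPrimes A B).card : ℝ) := by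
  have hεhalf : ∀ᶠ ε : ℝ in 𝓝[>] 0, ε ≤ 1 / 2 :=
    eventually_nhdsWithin_of_eventually_nhds (eventually_le_nhds (by norm_num : (0 : ℝ) < 1 / 2))
  have hεpos : ∀ᶠ ε : ℝ in 𝓝[>] 0, 0 < ε := eventually_mem_nhdsWithin
  filter_upwards [eventually_card_Rm_ge hCU, hεhalf, hεpos] with ε hR hε hε0
  filter_upwards [hR, eventually_card_intervalPrimes_ge 4 hκ,
    eventually_facts_Rm (K := 1) (δ := δ) hCU one_pos hε0 hε] with x hRx hIx hfx
  obtain ⟨hL1, -, -, -, -, -, -, -, hδL⟩ := hfx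
  intro m hm1 hmev hmW A B hA hB hAB
  refine hIx A B hA hB (le_trans ?_ hAB)
  have hN := hRx m hm1 hmev hmW
  set L := Real.log x with hLdef
  have hL0 : 0 < L := by linarith
  have hx0 : (0 : ℝ) ≤ x := Nat.cast_nonneg _
  -- `x/L⁴ ≤ δ · x/(8 L⁴) · L` since `δ L ≥ 8`
  have h1 : (x : ℝ) / L ^ 4 ≤ δ * ((x : ℝ) / (8 * L ^ 4)) * L := by
    rw [show δ * ((x : ℝ) / (8 * L ^ 4)) * L = (δ * L / 8) * ((x : ℝ) / L ^ 4) by ring]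
    have h8 : 1 ≤ δ * L / 8 := by
      rw [le_div_iff₀ (by norm_num : (0 : ℝ) < 8)]
      have := (div_le_iff₀ hδ).1 hδL
      linarith
    exact le_mul_of_one_le_left (by positivity) h8
  calc (x : ℝ) / L ^ 4 ≤ δ * ((x : ℝ) / (8 * L ^ 4)) * L := h1
    _ ≤ δ * ((Rm C_U ε x m).card : ℝ) * L := by
        have := mul_le_mul_of_nonneg_left hN hδ.le
        exact mul_le_mul_of_nonneg_right this hL0.le

end Maynard2016

end Literature.NumberTheory.Sieve
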